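import Literature.NumberTheory.EllipticCurves.HeegnerPointsKolyvaginStructure
import HarnessLib

/-!
# BirchSwinnertonDyer / SelmerRank — crux `SelmerRankLB` (stmt-BirchSwinnertonDyer-0131),
# line `heegner_order`, stub **HZ** `stub_kolyvagin_structure`: closure modulo two named facts

Registered stub **HZ** of the skeleton `Cruxes/SelmerRankLB/Lines/heegner_order.lean` (the ONLY
place where Selmer groups enter that line): for a globally minimal elliptic `W/ℚ`, a prime `p ≥ 5`
of good ordinary reduction with `ρ̄_{E,p}` surjective, and an imaginary quadratic `K` with the
Heegner hypothesis for `N_E`, `d_K ∉ {−3, −4}` odd, `p ∤ d_K`, `p` split in `K`, there are a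
modular parametrisation `Dt`, an orientation `β`, an embedding `ι : K → ℂ`, a square-free product
`n` of Kolyvagin primes, a Kolyvagin–Heegner datum `d` of conductor `n` and a level `1 ≤ M ≤ M(n)`
with `c_M(n) ≠ 0`, `ν(n) + 1 = max(c, c')` and `ν(n) + min(c, c')` even, where
`c = corank_{ℤ_p} Sel_{p^∞}(E/ℚ)`, `c' = corank_{ℤ_p} Sel_{p^∞}(E^{(d_K)}/ℚ)` and
`ν(n) = #{ℓ ∣ n}`.

This is KOLYVAGIN'S CONJECTURE (`κ^∞ ≠ 0`) together with KOLYVAGIN'S STRUCTURE THEOREM for the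
Heegner-point Kolyvagin system `κ^∞ = {c_M(n) : n ∈ Λ, 1 ≤ M ≤ M(n)}` (tree:
`KolyvaginHeegnerData.kolyvaginClass`, `Zhang2014.IsKolyvaginPrime`, `Zhang2014.levelIndex`, file
`HeegnerPointsOfConductor`) — two theorems in print of size XL, neither in Mathlib nor in the tree:

* `Literature.NumberTheory.EllipticCurves.BurungaleEtAl2026_exists_kolyvaginClass_ne_zero`
  (F_A): A. Burungale, F. Castella, G. Grossi, C. Skinner, *Non-vanishing of Kolyvagin systems and
  Iwasawa theory*, Camb. J. Math. 14 (2026) 285–348 = arXiv:2312.09301, **Thm. 1** (§0.1): for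
  `E/ℚ`, `p` odd good ordinary, `K` with (Heeg), (disc) `d_K` odd `≠ −3`, (tor) `E(K)[p] = 0`,
  `p` split in `K`, and the rational anticyclotomic main conjecture — supplied in the paper for
  `p > 3` under (irr) — some `κ_n^{Heeg}`, `n ∈ 𝒩_{Heeg}`, is non-zero;
* `Literature.NumberTheory.EllipticCurves.Kolyvagin1991_selmerCorank_of_kolyvaginClass_ne_zero`
  (F_B): V. A. Kolyvagin, *On the structure of Selmer groups*, Math. Ann. 291 (1991) 253–259,
  **Thm. 4** (W. Zhang, Camb. J. Math. 2 (2014), Thm. 1.2 and Thm. 11.2 (i); BCGS Cor. 1): if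
  `κ^∞ ≠ 0` with order of vanishing `f = ord κ^∞`, then one of `Sel_{p^∞}(E/ℚ)`,
  `Sel_{p^∞}(E^K/ℚ)` has `ℤ_p`-corank `f + 1` and the other has corank `r ≤ f` with `f − r` even
  (the two being the `±`-eigenspaces of `Sel_{p^∞}(E/K)` under complex conjugation, Kolyvagin,
  loc. cit., paragraph before Thm. 4).

Both are named facts (`def … : Prop`) of the tree in its own vocabulary, file
`Literature/NumberTheory/EllipticCurves/HeegnerPointsKolyvaginStructure.lean` (written for this stub
and relocated there by the gate, p164835); the stub is then
`stub_kolyvagin_structure_of_facts : F_A → F_B → <registered signature verbatim>`: (irr) comes from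
surjectivity (`hasIrreducibleModPGaloisRep_of_hasSurjectiveModNGaloisRep`), (tor) from
`torsionBy_eq_bot_of_isImaginaryQuadratic` (Gross 1991, §2), `p ∤ N_E` from good reduction
(`WeierstrassCurve.dvd_conductorNorm_iff_not_hasGoodReductionAtPrime`); F_A makes the set of
depths `ν(n)` of non-zero classes non-empty, a minimiser (`Nat.find`) is the witness, and F_B at the
minimiser gives `{c, c'} = {ν + 1, r}` with `r ≤ ν`, `ν − r` even, i.e. `ν + 1 = max(c, c')` and
`ν + min(c, c')` even. CONDITIONAL: it closes stub HZ only modulo {F_A, F_B}.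

## The printed statements

* BCGS, §0.1 (held text `paper:arxiv-2312.09301`, chunk 3): "Let `K` be an imaginary quadratic
  field of discriminant `−D_K < 0` such that (Heeg) every prime `ℓ | N` splits in `K`, and fix an
  integral ideal `𝔑 ⊂ 𝒪_K` with `𝒪_K/𝔑 = ℤ/Nℤ`. Assume also that (disc) `D_K` is odd and
  `D_K ≠ −3`. … the cyclic `N`-isogeny `ℂ/𝒪_m → ℂ/(𝔑 ∩ 𝒪_m)^{−1}` defines a point
  `x_m ∈ X_0(N)(K[m])`. Fix a modular parameterisation `π : X_0(N) → E`. The Heegner point of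
  conductor `m` is defined by `P[m] := π(x_m) ∈ E(K[m])`. We call `ℓ` a Kolyvagin prime if `ℓ` is
  inert in `K`, coprime to `Np`, and `M(ℓ) := min{ord_p(ℓ+1), ord_p(a_ℓ)} > 0 … Let `𝒩_{Heeg}` be
  the set of squarefree products of Kolyvagin primes, and for `n ∈ 𝒩_{Heeg}` put
  `M(n) := min{M(ℓ) : ℓ ∣ n}` if `n > 1` and `M(1) := ∞`. … suppose that (tor) `E(K)[p] = 0`. From
  the Kummer images of the Heegner points `P[n]`, Kolyvagin constructed a system of classes
  `{κ_n^{Heeg} ∈ H¹(K, T/I_nT) : n ∈ 𝒩_{Heeg}}`, where `I_n = p^{M(n)}ℤ_p`. … THEOREM 1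
  (Kolyvagin's conjecture). Let `E/ℚ` be an elliptic curve, and let `p` be an odd prime of good
  ordinary reduction for `E`. Let `K` be a quadratic imaginary field satisfying (Heeg), (disc),
  (tor), and such that `p` splits in `K`. Assume that the rational anticyclotomic Main Conjecture
  holds. Then there exists `n ∈ 𝒩_{Heeg}` such that `κ_n^{Heeg} ≠ 0`. In particular,
  `{κ_n^{Heeg}} ≠ 0` in both of the following cases: … ∘ `p > 3` satisfies (irr) [`E[p]` is an
  irreducible `G_ℚ`-module]." Construction, §1.1.2 (chunk 8): `D_ℓ = Σ_{i=1}^{ℓ} i σ_ℓ^i`,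
  `D_n = Π D_ℓ`, `κ̃_n := Σ_{σ ∈ S} σ D_n(P[n]) ∈ (E(K[n])/p^{M(n)}E(K[n]))^{𝒢(n)}` for a set `S`
  of representatives of `𝒢(n)/G(n)`; "(tor) ensures that the restriction map
  `H¹(K, T^{(M(n))}) → H¹(K[n], T^{(M(n))})^{𝒢(n)}` is an isomorphism, and `κ_n^{Heeg}` is
  defined to be the unique class which restricts to the image of `κ̃_n`" — i.e. exactly the tree's
  `P(n) = KolyvaginHeegnerData.derivedPoint` (Gross (4.1)) and `c_{M(n)}(n)` (Gross (4.4),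
  McCallum's cocycle (4.6); Zhang (3.21)).
* Kolyvagin 1991 (held text `paper:doi-10-1007-bf01445205`, the author's typescript, whose
  Thm. 2.3 is the "[24, Theorem 4]" of W. Zhang 2014, Thm. 1.2 / Thm. 11.2): §1: `K = ℚ(√D)`,
  `0 > D ≡ □ (mod 4N)`, `D ≠ −3, −4`; `ℓ ∈ B(E)` (odd primes with `ρ : G(ℚ̄/ℚ) → Aut T_ℓ`
  surjective); Kolyvagin primes `p ∤ N` inert with
  `n(p) = ord_ℓ(p + 1, a_p) ≥ 1`, `Λ^r` the products of `r` distinct such primes,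
  `n(λ) = min_{p ∣ λ} n(p)`, `n(1) = ∞`; the classes `τ_{λ,n} ∈ H¹(K, E_M)`, `λ ∈ Λ`,
  `1 ≤ n ≤ n(λ)`, `M = ℓ^n`, with `res(τ_{λ,n}) = P_λ (mod M E(K_λ))`, `P_λ = J_λ I_λ y_λ`;
  "CONJECTURE 1.1 [Kolyvagin's conjecture]. `T ≠ {0}`."; `f` = the minimal `r` such that
  `m_r < ∞` (= the least `r` with some `τ_{λ,n} ≠ 0`, `λ ∈ Λ^r`). §2: "the group
  `S^ν = lim S^ν_{ℓ^n}` is isomorphic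
  to a direct sum of `(ℚ_ℓ/ℤ_ℓ)^{r^ν}` and a finite group `X^ν`. The group `S^ν_{ℓ^n}` coincides
  with the maximal `ℓ^n`-torsion subgroup of `S^ν` and with the Selmer group of level `ℓ^n` for
  `E^ν` over `ℚ`. Here `E^ν` is `E` if `(−1)^{ν+1}ε = 1`, and `E^ν` is the form of `E` over `K`
  otherwise
  [`ε = (−1)^{g−1}`, `g = ord_{s=1} L(E, s)`]. THEOREM 2.3 [Theorem 4]. Suppose Conjecture 1.1 is
  true. Then `r^{(f+1)} = f + 1`, `r^{(f)} ≤ f`, and `f − r^{(f)}` is even." (`(i)` = the residue of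
  `i` mod `2`.)
* W. Zhang 2014 (held text `paper:doi-10-4310-cjm-2014-v2-n2-a2`), p. 194: `Λ`, `M(n)`,
  `κ^∞ = {c_M(n) ∈ H¹(K, E[p^M]) : n ∈ Λ, M ≤ M(n)}`; p. 195: "The vanishing order `ord κ^∞` … is
  the minimal number of prime factors of `n ∈ Λ` such that `c_M(n) ≠ 0` for some `M ≤ M(n)`";
  THEOREM 1.2 / THEOREM 11.2 (Kolyvagin) (p. 248): "`(p, DN) = 1` and `N⁻` is square-free with even
  number of factors; `ρ̄_{E,p}` surjective [`p ≥ 5`, p. 193]. Assume that `M_∞` is finite and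
  denote by `ν_∞` the vanishing order of `κ^∞`. Then (i) `r_p^{ε_{ν_∞}}(E/K) = ν_∞ + 1` and
  `0 ≤ ν_∞ − r_p^{−ε_{ν_∞}}(E/K) ≡ 0 mod 2`", `ε_ν = ε(E/ℚ)(−1)^{ν+1}`, `r_p^±` the coranks of the
  `±`-eigenspaces of `Sel_{p^∞}(E/K)` under complex conjugation.

## The Lean statements of the two facts (`HeegnerPointsKolyvaginStructure`): faithfulness

* DATA. The sources FIX `π` (resp. `γ`), `𝔑` (resp. `i_1`) and `K ⊂ ℂ`, and the `K[n]`-rational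
  points `P[n] = y(n)` exist by CM theory (Gross 1991, §3; BCGS "By the theory of complex
  multiplication"); in the tree the parametrisation is a `ModularParametrizationData` (modularity,
  BCDT 2001; `nonempty_modularParametrizationData`), the orientation is `β` with
  `4N ∣ β² − d_K` (it exists under the Heegner hypothesis, `exists_dvd_sq_sub_discr`), and the
  level-`n` data (`y(n)`, generators `σ_ℓ`, representatives `S`, an embedding `K[n] → K̄`) are a
  `KolyvaginHeegnerData Dt β ι n` whose existence is CM theory and is NOT proved in the tree (cf.
  the precedent `exists_isHeegnerPoint`). F_A therefore asserts the EXISTENCE of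
  `(Dt, β, ι, n, d, M)`:
  the printed theorem for any one fixed choice, together with the existence of that choice. F_B is
  universally quantified over `(Dt, β, ι)` and over the data.
* THE CLASS. `d.kolyvaginClass hp M = c_M(n)` is McCallum's cocycle of `P(n)` relative to
  `E(K[n]) ⊆ E(K̄)`, with junk value `0` unless `E(K[n])` has no `p`-torsion (Gross, Lemma 4.3;
  BCGS: "(tor) ensures …") and `[P(n)]` is `𝒢(n)`-invariant mod `p^M` (Gross, Prop. 3.6; BCGS: "one
  can show the inclusion"; `M ≤ M(n)`): under the printed hypotheses the junk branch is not taken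
  and `c_M(n) ≠ 0` is the printed `κ ≠ 0` (`KolyvaginHeegnerData.kolyvaginClass_ne_zero`). Its
  (non-)vanishing does not depend on the choices inside `d`: another generator `σ_ℓ^k`
  (`p ∤ k`) changes the class by the unit `k^{±1}` of `ℤ/p^M` (as `Tr_ℓ y(n) = a_ℓ y(n/ℓ) ≡ 0`),
  another `S` does not change `P(n) mod p^M`, another embedding conjugates by `Γ_K` (trivial on
  `H¹(K, ·)`); BCGS's "slight modification" of `κ_n` (Howard's twist by `⊗ G_ℓ`) is an isomorphism.
* LEVELS. BCGS's `κ_n^{Heeg}` is `c_{M(n)}(n)` for `n > 1`, and for `n = 1` the Kummer image of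
  `P_K` in `H¹(K, T) = lim_M H¹(K, E[p^M])`, non-zero iff some `c_M(1)`, `M ≥ 1`, is; the classes
  `c_M(n)`, `M ≤ M(n)`, are the reductions of `c_{M(n)}(n)` (BCGS Lemma 1.1.4), so
  "`κ_n^{Heeg} ≠ 0`" ⟺ "`c_M(n) ≠ 0` for some `1 ≤ M ≤ M(n)`" — the form used here (`1 ≤ M` and
  `(M : ℕ∞) ≤ Zhang2014.levelIndex W p n`), which is also Kolyvagin's `1 ≤ n ≤ n(λ)` and Zhang's
  `M ≤ M(n)`; and BCGS's / Zhang's `ord` is Kolyvagin's `f`.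
* `n ∈ Λ` is `KolyvaginDescent.KolSupp (Zhang2014.IsKolyvaginPrime N_E W K p) n` (square-free, every
  `ℓ ∣ n` prime to `N_E d_K p`, inert, `M(ℓ) > 0` — Zhang (xii) = BCGS §0.1 = Kolyvagin §1 with
  `n(p) ≥ 1`); `ν(n) = n.primeFactors.card`.
* HYPOTHESES of F_A: as printed and as already transcribed in the tree (hypothesis `hBCGS` of
  `yanZhu_analyticRank_eq_one_of_selmerCorank_eq_one_of_bcgs_of_rootNumber_eq_neg_one`): `3 < p`,
  good ordinary (`HasGoodReductionAtPrime`, `p ∤ a_p`), (irr) `HasIrreducibleModPGaloisRep`,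
  (Heeg) for `N = W.conductorNorm ℤ`, (disc) `Odd d_K ∧ d_K ≠ −3`, (tor)
  `AddSubgroup.torsionBy E(K) p = ⊥`, `p` split = `SatisfiesHeegnerHypothesis p K`.
* HYPOTHESES of F_B: the union of Kolyvagin's (`D ≡ □ (4N)` ⇐ Heegner hypothesis, `D ≠ −3, −4`,
  `ℓ ∈ B(E)` ⇐ `p ≥ 5` with `ρ̄_{E,p}` onto, Serre) and Zhang's (`(p, DN) = 1`, `ρ̄` onto,
  `p ≥ 5`); "`κ^∞ ≠ 0` with `f = ord κ^∞`" is carried by a witness `(n, d, M)` with `c_M(n) ≠ 0`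
  whose `ν(n)` is minimal among all witnesses `(n', d', M')` for the same `(Dt, β, ι)`.
* CONCLUSION of F_B: Kolyvagin's `r^ν` are, by the quoted paragraph, the coranks of
  `Sel_{ℓ^∞}(E^ν/ℚ)`, `{E^0, E^1} = {E, E^K}`, `E^K = E^{(d_K)}` (tree `W.quadraticTwist d_K`,
  `WeierstrassCurve.selmerCorank`); which of the two is `E` is decided by `ε = (−1)^{g−1}` (Zhang:
  by the root number, `ε_ν = ε(E/ℚ)(−1)^{ν+1}`, `Sel⁺ = Sel(E/ℚ)`, `Sel⁻ = Sel(E^K/ℚ)` for odd `p`,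
  cf. the tree's `selmerCorank_baseChange_quadratic_holds` for the sum). The statement here keeps
  the disjunction and FORGETS the sign rule — weaker than print, never stronger.
  `TODO(general form)`: the sign rule; Zhang's Shimura-curve case `N⁻ ≠ 1`; clause (ii) of
  Thm. 11.2 and the invariants of `Ш` (Kolyvagin Thm. 1–3).

## References

* [BurungaleEtAl2026] A. Burungale, F. Castella, G. Grossi, C. Skinner, Camb. J. Math. 14 (2026),
  285–348 = arXiv:2312.09301: §0.1 (Heeg), (disc), (tor), Thm. 1, Cor. 1; §1.1.2.
* [Kolyvagin1991MathAnn] V. A. Kolyvagin, Math. Ann. 291 (1991), 253–259: §1 (Kolyvagin's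
  conjecture = Conj. 1.1 of the typescript), §2 Thm. 4 (= Thm. 2.3 of the typescript) and the
  paragraph before it.
* [WZhang2014] W. Zhang, Camb. J. Math. 2 (2014), 191–253: p. 194 (`Λ`, `M(n)`, `κ^∞`), Thm. 1.2
  (p. 195), Thm. 11.2 (p. 248).
* [GrossLMS1991] B. H. Gross, LMS LNS 153 (1991): §2 (after (2.2)), §3, §4 ((4.1), Lemma 4.3,
  (4.4), (4.6)).
-/

noncomputable section

open scoped Classical

/-! ## Stub HZ modulo the two facts -/

-- the summit namespace `BirchSwinnertonDyer.BirchSwinnertonDyer` repeats a component by design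
set_option linter.dupNamespace false

namespace Summit.BirchSwinnertonDyer.BirchSwinnertonDyer.Theorems

open Literature.NumberTheory.EllipticCurves Literature.NumberTheory.EllipticCurves.ModularForms
  WeierstrassCurve

/-- **Stub HZ (`stub_kolyvagin_structure`) of line `heegner_order`, closed MODULO the named facts
`BurungaleEtAl2026_exists_kolyvaginClass_ne_zero` (F_A: Burungale–Castella–Grossi–Skinner 2026,
Thm. 1 — the non-vanishing `κ^∞ ≠ 0` for `p > 3` good ordinary, (irr), (Heeg), (disc), (tor),
`p` split) and `Kolyvagin1991_selmerCorank_of_kolyvaginClass_ne_zero` (F_B: Kolyvagin 1991, Thm. 4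
= W. Zhang 2014, Thm. 11.2 (i) — at `f = ord κ^∞` one of `corank Sel_{p^∞}(E/ℚ)`,
`corank Sel_{p^∞}(E^{(d_K)}/ℚ)` is `f + 1`, the other is `≤ f` with even defect).** Behind the two
hypotheses the conclusion is the registered signature verbatim: for globally minimal elliptic `W/ℚ`,
`p ≥ 5` good ordinary with `ρ̄_{E,p}` onto, `K` imaginary quadratic with `d_K ∉ {−3, −4}`,
`p ∤ d_K`, the Heegner hypothesis for `N_E`, `d_K` odd and `p` split in `K`, there are
`Dt, β, ι`, a square-free product `n` of Kolyvagin primes, a datum `d` of conductor `n` and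
`1 ≤ M ≤ M(n)` with `c_M(n) ≠ 0`, `ν(n) + 1 = max(c, c')` and `ν(n) + min(c, c')` even. Proof:
(irr) from surjectivity (`hasIrreducibleModPGaloisRep_of_hasSurjectiveModNGaloisRep`), (tor)
`E(K)[p] = 0` from surjectivity and `p` odd (`torsionBy_eq_bot_of_isImaginaryQuadratic`, Gross
1991 §2), `p ∤ N_E` from good reduction (`dvd_conductorNorm_iff_not_hasGoodReductionAtPrime`); F_A
makes the set of depths `ν(n)` of non-zero classes `c_M(n)` (`n ∈ Λ`, `1 ≤ M ≤ M(n)`) of the system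
attached to `(Dt, β, ι)` non-empty; its least element (`Nat.find`) is attained at a witness
`(n, d, M)`, to which F_B applies: `{c, c'} = {ν(n) + 1, r}` with `r ≤ ν(n)` and `ν(n) − r` even, so
`max(c, c') = ν(n) + 1`, `min(c, c') = r` and `ν(n) + r ≡ ν(n) − r ≡ 0 (mod 2)`. CONDITIONAL; it
does not close the stub. [cite: BurungaleEtAl2026, Thm. 1 and Cor. 1 (arXiv:2312.09301, §0.1)]
[cite: Kolyvagin1991MathAnn, §2 Thm. 4]
[cite: WZhang2014, Thm. 1.2 (p. 195) and Thm. 11.2 (p. 248)] -/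
theorem stub_kolyvagin_structure_of_facts :
    BurungaleEtAl2026_exists_kolyvaginClass_ne_zero →
      Kolyvagin1991_selmerCorank_of_kolyvaginClass_ne_zero →
      ∀ (W : WeierstrassCurve ℚ) [W.IsElliptic] [W.IsGloballyMinimal] (p : ℕ) [hp : Fact p.Prime],
        5 ≤ p → W.HasGoodReductionAtPrime p → ¬ (p : ℤ) ∣ W.frobeniusTrace p →
        W.HasSurjectiveModNGaloisRep p →
        ∀ (K : Type) [Field K] [NumberField K], IsImaginaryQuadratic K →
          NumberField.discr K ≠ -3 → NumberField.discr K ≠ -4 → ¬ ((p : ℤ) ∣ NumberField.discr K) →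
          ∀ [NeZero (W.conductorNorm ℤ)], SatisfiesHeegnerHypothesis (W.conductorNorm ℤ) K →
          Odd (NumberField.discr K) → SatisfiesHeegnerHypothesis p K →
          ∃ (Dt : ModularParametrizationData W (W.conductorNorm ℤ)) (β : ℤ) (ι : K →+* ℂ) (n : ℕ)
            (d : KolyvaginHeegnerData Dt β ι n) (M : ℕ),
            Squarefree n ∧ (∀ ℓ ∈ n.primeFactors, Zhang2014.IsKolyvaginPrime (W.conductorNorm ℤ) W K p ℓ) ∧
            1 ≤ M ∧ (M : ℕ∞) ≤ Zhang2014.levelIndex W p n ∧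
            d.kolyvaginClass hp.out M ≠ 0 ∧
            n.primeFactors.card + 1 =
              max (W.selmerCorank p) ((W.quadraticTwist (NumberField.discr K : ℚ)).selmerCorank p) ∧
            Even (n.primeFactors.card +
              min (W.selmerCorank p) ((W.quadraticTwist (NumberField.discr K : ℚ)).selmerCorank p)) := by
  intro hA hB W _ _ p hp h5 hgood hord hsurj K _ _ hK h3 h4 hpd _ hH hodd hps
  have hpP : p.Prime := hp.out
  haveI : NeZero (p : ℚ) := ⟨by exact_mod_cast hpP.ne_zero⟩
  -- (irr), (tor) from the surjectivity of `ρ̄_{E,p}`; `p ∤ N_E` from good reduction at `p`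
  have hirr : W.HasIrreducibleModPGaloisRep p :=
    hasIrreducibleModPGaloisRep_of_hasSurjectiveModNGaloisRep W p hsurj
  have htor : AddSubgroup.torsionBy (W.baseChange K).toAffine.Point (p : ℤ) = ⊥ :=
    torsionBy_eq_bot_of_isImaginaryQuadratic W K hK hpP (by omega) hsurj
  have hpN : ¬ (p ∣ W.conductorNorm ℤ) := fun h ↦
    (W.dvd_conductorNorm_iff_not_hasGoodReductionAtPrime p).mp h hgood
  -- F_A (BCGS Thm. 1): some class `c_{M₀}(n₀)` of the system attached to `(Dt, β, ι)` is non-zero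
  obtain ⟨Dt, β, ι, n₀, d₀, M₀, hΛ₀, hM₀, hM₀le, hne₀⟩ :=
    hA W p (by omega) hgood hord hirr K hK hH hodd h3 htor hps
  -- the order of vanishing: minimise `ν(n)` over the non-zero classes of this system
  have hex : ∃ k, ∃ (n : ℕ) (d : KolyvaginHeegnerData Dt β ι n) (M : ℕ),
      KolyvaginDescent.KolSupp (Zhang2014.IsKolyvaginPrime (W.conductorNorm ℤ) W K p) n ∧
        1 ≤ M ∧ (M : ℕ∞) ≤ Zhang2014.levelIndex W p n ∧ d.kolyvaginClass hp.out M ≠ 0 ∧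
        n.primeFactors.card = k :=
    ⟨_, n₀, d₀, M₀, hΛ₀, hM₀, hM₀le, hne₀, rfl⟩
  obtain ⟨n, d, M, hΛ, hM, hMle, hne, hcard⟩ := Nat.find_spec hex
  have hmin : ∀ (n' : ℕ) (d' : KolyvaginHeegnerData Dt β ι n') (M' : ℕ),
      KolyvaginDescent.KolSupp (Zhang2014.IsKolyvaginPrime (W.conductorNorm ℤ) W K p) n' →
      1 ≤ M' → (M' : ℕ∞) ≤ Zhang2014.levelIndex W p n' → d'.kolyvaginClass hp.out M' ≠ 0 →
      n.primeFactors.card ≤ n'.primeFactors.card := by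
    intro n' d' M' hΛ' hM' hM'le hne'
    rw [hcard]
    exact Nat.find_min' hex ⟨n', d', M', hΛ', hM', hM'le, hne', rfl⟩
  -- F_B: Kolyvagin's structure theorem at the minimiser
  have hstruct := hB W p h5 hsurj K hK h3 h4 hpd hpN hH Dt β ι n d M hΛ hM hMle hne hmin
  obtain ⟨hsq, hkol⟩ := hΛ
  refine ⟨Dt, β, ι, n, d, M, hsq, hkol, hM, hMle, hne, ?_, ?_⟩
  · rcases hstruct with ⟨hc, hc', -⟩ | ⟨hc', hc, -⟩
    · rw [max_eq_left (by omega)]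
      omega
    · rw [max_eq_right (by omega)]
      omega
  · rcases hstruct with ⟨hc, hc', hev⟩ | ⟨hc', hc, hev⟩
    · rw [min_eq_right (by omega)]
      have h2 := Nat.even_iff.mp hev
      exact Nat.even_iff.mpr (by omega)
    · rw [min_eq_left (by omega)]
      have h2 := Nat.even_iff.mp hev
      exact Nat.even_iff.mpr (by omega)

end Summit.BirchSwinnertonDyer.BirchSwinnertonDyer.Theorems

end
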